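import Summits.ValiantsHypothesis.ValiantsHypothesis.Theorems.KPlusLogSqLawTropicalBMasterLawComplete

/-!
# Route `KPlusLogSqLaw`, crux `TropicalB` (stmt-ValiantsHypothesis-19771) — MULTI-EXCHANGE IS COMPLETE:
# certificates may be taken INTEGRAL — a term sequence is realisable iff no MULTISET of its positions repackages badly

HONEST FRAMING.  Helper file (seat val-sym-trop-p1 g26, cell `pub-symmetroid`, 2026-08-29; `--supports stmt-ValiantsHypothesis-19771
--as helper`) toward the registered stubs `stub_tropThin` / `stub_tropFat` of `Cruxes/TropicalB/Lines/birth.lean` (crux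
`Summit.ValiantsHypothesis.ValiantsHypothesis.Theses.KPlusLogSqLaw.TropicalB`, route `KPlusLogSqLaw`).  An exact criterion (route-independent
imports); it bounds nothing: `TropicalB` / both stubs stay OPEN; nothing on `WeakLifting`, the cell's census, DoorA26 / DoorA34,
`MatrixDescartes` (stmt-ValiantsHypothesis-18050) or VP ≠ VNP.

THE POINT.  The realisability criterion (`MasterLaw.exists_design_iff_no_certificate`, part 2 of the converse of the master law) quantifies over
RATIONAL multiplier systems.  Clearing denominators, the multipliers may be taken in `ℕ`: a certificate is then literally a finite MULTISET of
pairs (chain position `k`, chain-supported competitor `q ≠ p k`) — positions used WITH REPETITION — whose competitors carry, in total, exactly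
the incidences of the positions they are charged to (a REPACKAGING), and whose competitor slopes, summed over the positions `≤ k'`, never
exceed the chain slopes summed over the same positions (`k' < n`).  This is the hypothesis of the tree's MULTI-EXCHANGE LAW
`MultiExchange.prefix_deficit` (val-sym-trop-p4 g5; there: a list `P` of dominant terms at non-decreasing slopes, repetitions allowed, and
a repackaging `Q`; sorting each position's competitors by decreasing slope excess turns «all position-prefixes ≥ 0» into «all list-prefixes
≥ 0») — so the multi-exchange law with repetitions is not one law among others but the COMPLETE criterion:
* `exists_design_iff_no_natCertificate` — (∃ design and slopes realising `p 0, …, p n` as unique optima) ⟺ every `ℕ`-valued multiplier system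
  `c k q` (supported on `k ≤ n`, `q ≠ p k` chain-supported) that repackages (`Σ c·ev F (p k) = Σ c·ev F q` for every weight table `F`) with
  dominated position-prefix slope sums is identically `0`.
[this cell; LP duality and clearing denominators are folklore]
-/

set_option linter.dupNamespace false
set_option autoImplicit false

namespace Summit.ValiantsHypothesis.ValiantsHypothesis.Theorems.KPlusLogSqLaw.MasterLaw

open Summit.ValiantsHypothesis.ValiantsHypothesis.Theorems.MatrixDescartes.Negative
open Summit.ValiantsHypothesis.ValiantsHypothesis.Theorems.KPlusLogSqLaw.ConvexPosition
open Summit.ValiantsHypothesis.ValiantsHypothesis.Theorems.LacunarySymmetroidMatrixDescartes.TropicalCensus (slope)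
open scoped BigOperators
open Finset

variable {m K : ℕ}

/-- **MULTI-EXCHANGE IS COMPLETE (integral certificates, kernel iff).**  For any exponents `d` and terms `p 0, …, p n` of format `(m, K)`:
the sequence is realised by some design at some increasing integer slopes iff the only `ℕ`-valued multiplier system `c k q` on pairs
(`k ≤ n`, `q ≠ p k` with all incidences among the chain's) such that the competitors REPACKAGE the charged positions
(`Σ_{k,q} c k q · ev F (p k) = Σ_{k,q} c k q · ev F q` for every weight table `F`) and the competitor slopes charged to the positions `≤ k'`
never exceed the chain slopes there (`k' < n`) is `c = 0`. [this cell] -/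
theorem exists_design_iff_no_natCertificate (d : Fin K → ℕ) (n : ℕ) (p : ℕ → Equiv.Perm (Fin m) × (Fin m → Fin K)) :
    (∃ (v ε : Fin m → Fin m → Fin K → ℤ) (θ : ℕ → ℤ), (∀ i j l, (ε i j l).natAbs ≤ 1) ∧
      (∀ k < n, θ k < θ (k + 1)) ∧ ∀ k ≤ n, IsDominant d v ε (θ k) (p k)) ↔
    (∀ c : ℕ → (Equiv.Perm (Fin m) × (Fin m → Fin K)) → ℕ,
      (∀ k q, c k q ≠ 0 → k ≤ n ∧ q ≠ p k ∧ ∀ b, ∃ k' ≤ n, (p k').1 b = q.1 b ∧ (p k').2 b = q.2 b) →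
      (∀ F : Fin m × Fin m × Fin K → ℤ,
        ∑ k ∈ range (n + 1), ∑ q, (c k q : ℤ) * ev F (p k) = ∑ k ∈ range (n + 1), ∑ q, (c k q : ℤ) * ev F q) →
      (∀ k < n, ∑ k' ∈ range (k + 1), ∑ q, (c k' q : ℤ) * slope d q ≤ ∑ k' ∈ range (k + 1), ∑ q, (c k' q : ℤ) * slope d (p k')) →
      ∀ k q, c k q = 0) := by
  classical
  rw [exists_design_iff_no_certificate]
  constructor
  · -- rational criterion ⇒ integral criterion: cast
    intro h c hsupp hbal hpre k q
    have h0 := h (fun k q => (c k q : ℚ)) (fun k q => by positivity)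
      (fun k q hkq => hsupp k q (by exact_mod_cast hkq))
      (fun F => by
        have hb := hbal F
        have : (∑ k ∈ range (n + 1), ∑ q, (c k q : ℚ) * ((ev F (p k) : ℚ) - (ev F q : ℚ))) =
            (((∑ k ∈ range (n + 1), ∑ q, (c k q : ℤ) * ev F (p k)) : ℤ) : ℚ) -
              (((∑ k ∈ range (n + 1), ∑ q, (c k q : ℤ) * ev F q) : ℤ) : ℚ) := by
          push_cast
          rw [← Finset.sum_sub_distrib]
          refine Finset.sum_congr rfl fun k _ => ?_
          rw [← Finset.sum_sub_distrib]
          refine Finset.sum_congr rfl fun q _ => ?_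
          ring
        rw [this, hb, sub_self])
      (fun k hk => by
        have hp := hpre k hk
        have : (∑ k' ∈ range (k + 1), ∑ q, (c k' q : ℚ) * ((slope d (p k') : ℚ) - (slope d q : ℚ))) =
            (((∑ k' ∈ range (k + 1), ∑ q, (c k' q : ℤ) * slope d (p k')) : ℤ) : ℚ) -
              (((∑ k' ∈ range (k + 1), ∑ q, (c k' q : ℤ) * slope d q) : ℤ) : ℚ) := by
          push_cast
          rw [← Finset.sum_sub_distrib]
          refine Finset.sum_congr rfl fun k _ => ?_
          rw [← Finset.sum_sub_distrib]
          refine Finset.sum_congr rfl fun q _ => ?_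
          ring
        rw [this, sub_nonneg]
        exact_mod_cast hp)
      k q
    exact_mod_cast h0
  · -- integral criterion ⇒ rational criterion: clear denominators
    intro h lam hlam hsupp hbal hpre
    -- the finitely many rationals `lam k q`, `k ≤ n`
    obtain ⟨N, hNpos, hN⟩ := exists_nat_mul_integral
      (fun kq : Fin (n + 1) × (Equiv.Perm (Fin m) × (Fin m → Fin K)) => lam kq.1 kq.2)
    choose z hz using hN
    have hNq : (0 : ℚ) < (N : ℚ) := by exact_mod_cast hNpos
    have hz0 : ∀ kq, 0 ≤ z kq := by
      intro kq
      have : (0 : ℚ) ≤ (z kq : ℚ) := by rw [← hz kq]; exact mul_nonneg hNq.le (hlam _ _)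
      exact_mod_cast this
    -- the integral multipliers
    let c : ℕ → (Equiv.Perm (Fin m) × (Fin m → Fin K)) → ℕ := fun k q =>
      if h : k < n + 1 then (z (⟨k, h⟩, q)).toNat else 0
    have hc_cast : ∀ k (hk : k < n + 1) q, ((c k q : ℤ) : ℚ) = (N : ℚ) * lam k q := by
      intro k hk q
      simp only [c, dif_pos hk]
      rw [Int.toNat_of_nonneg (hz0 _)]
      exact (hz (⟨k, hk⟩, q)).symm
    have hc_cast' : ∀ k (hk : k < n + 1) q, (c k q : ℚ) = (N : ℚ) * lam k q := by
      intro k hk q; rw [← hc_cast k hk q]; norm_cast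
    have hcsupp : ∀ k q, c k q ≠ 0 → k ≤ n ∧ q ≠ p k ∧ ∀ b, ∃ k' ≤ n, (p k').1 b = q.1 b ∧ (p k').2 b = q.2 b := by
      intro k q hk
      by_cases hkn : k < n + 1
      · refine hsupp k q ?_
        intro h0
        apply hk
        have := hc_cast' k hkn q
        rw [h0, mul_zero] at this
        exact_mod_cast this
      · simp only [c, dif_neg hkn] at hk; exact absurd rfl hk
    have hcbal : ∀ F : Fin m × Fin m × Fin K → ℤ,
        ∑ k ∈ range (n + 1), ∑ q, (c k q : ℤ) * ev F (p k) = ∑ k ∈ range (n + 1), ∑ q, (c k q : ℤ) * ev F q := by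
      intro F
      have hb := hbal F
      have : ((∑ k ∈ range (n + 1), ∑ q, (c k q : ℤ) * ev F (p k) : ℤ) : ℚ) -
          ((∑ k ∈ range (n + 1), ∑ q, (c k q : ℤ) * ev F q : ℤ) : ℚ) =
          (N : ℚ) * ∑ k ∈ range (n + 1), ∑ q, lam k q * ((ev F (p k) : ℚ) - (ev F q : ℚ)) := by
        push_cast
        rw [← Finset.sum_sub_distrib, Finset.mul_sum]
        refine Finset.sum_congr rfl fun k hk => ?_
        rw [← Finset.sum_sub_distrib, Finset.mul_sum]
        refine Finset.sum_congr rfl fun q _ => ?_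
        rw [hc_cast' k (Finset.mem_range.mp hk) q]; ring
      rw [hb, mul_zero, sub_eq_zero] at this
      exact_mod_cast this
    have hcpre : ∀ k < n, ∑ k' ∈ range (k + 1), ∑ q, (c k' q : ℤ) * slope d q ≤
        ∑ k' ∈ range (k + 1), ∑ q, (c k' q : ℤ) * slope d (p k') := by
      intro k hk
      have hp := hpre k hk
      have : ((∑ k' ∈ range (k + 1), ∑ q, (c k' q : ℤ) * slope d (p k') : ℤ) : ℚ) -
          ((∑ k' ∈ range (k + 1), ∑ q, (c k' q : ℤ) * slope d q : ℤ) : ℚ) =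
          (N : ℚ) * ∑ k' ∈ range (k + 1), ∑ q, lam k' q * ((slope d (p k') : ℚ) - (slope d q : ℚ)) := by
        push_cast
        rw [← Finset.sum_sub_distrib, Finset.mul_sum]
        refine Finset.sum_congr rfl fun k' hk' => ?_
        rw [← Finset.sum_sub_distrib, Finset.mul_sum]
        refine Finset.sum_congr rfl fun q _ => ?_
        rw [hc_cast' k' (by have := Finset.mem_range.mp hk'; omega) q]; ring
      have hnn : (0 : ℚ) ≤ ((∑ k' ∈ range (k + 1), ∑ q, (c k' q : ℤ) * slope d (p k') : ℤ) : ℚ) -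
          ((∑ k' ∈ range (k + 1), ∑ q, (c k' q : ℤ) * slope d q : ℤ) : ℚ) := by
        rw [this]; exact mul_nonneg hNq.le hp
      have : ((∑ k' ∈ range (k + 1), ∑ q, (c k' q : ℤ) * slope d q : ℤ) : ℚ) ≤
          ((∑ k' ∈ range (k + 1), ∑ q, (c k' q : ℤ) * slope d (p k') : ℤ) : ℚ) := by linarith
      exact_mod_cast this
    have hzero := h c hcsupp hcbal hcpre
    intro k q
    by_cases hkn : k < n + 1
    · have h1 := hc_cast' k hkn q
      rw [hzero k q] at h1
      simp only [Nat.cast_zero] at h1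
      rcases mul_eq_zero.mp h1.symm with h2 | h2
      · exact absurd h2 hNq.ne'
      · exact h2
    · by_contra hne
      exact hkn (by have := (hsupp k q hne).1; omega)

end Summit.ValiantsHypothesis.ValiantsHypothesis.Theorems.KPlusLogSqLaw.MasterLaw
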